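import Literature.Analysis.SpecialFunctions.LaguerrePolynomial
import Literature.Analysis.Complex.JensenPolynomialHyperbolicity
import Literature.NumberTheory.LFunctions.XiMoments
import HarnessLib

/-!
# The Laguerre skeleton of the Jensen polynomials of `ξ`

Two printed identities, in the tree's vocabulary (`jensenPoly γ d n = ∑_{j ≤ d} (d choose j) γ(n+j) X^j`,
GORZ 2019 §1; `laguerre α d = L_d^{(α)}`, Szegő (5.1.6)):

* `jensenPoly_pochhammerInv` (**Jensen polynomials of the Bessel/Gamma sequence are Laguerre
  polynomials**): for `b > 0`, `c ∈ ℝ` and the sequence `γ_k = c/(b)_k` (`(b)_k = b(b+1)⋯(b+k−1)`,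
  i.e. `γ_k = c·Γ(b)/Γ(b+k)`),
  `J^{d,n}_γ(X) = (c · d!/(b)_{n+d}) · L_d^{(b+n−1)}(−X)`
  — Dimitrov–Ben Cheikh 2009 §3 (`g_n(J̃_α; z) = (n!/Γ(n+α+1)) L_n^{(α)}`, shift `0`),
  O'Sullivan 2021 §3.3, and with the shift `n` verbatim O'Sullivan 2022 §9:
  `J^{d,n}_{1/Γ(·+β)}(X) = (d!/Γ(n+d+β)) L_d^{(n+β−1)}(−X)`;
* `xiTaylorCoeff_mul_ascPochhammer` : for the GORZ Taylor coefficients of `ξ`,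
  `γ(n) · (1/2)_n = 64 · M_{2n}` (`M_k = ∫₀^∞ Φ(u) u^k du` the moments of the Pólya–de Bruijn kernel),
  from the tree's `xiTaylorCoeff_eq_xiMoment` (`γ(n) = 64·4ⁿ·n!/(2n)!·M_{2n}`) and `(2n)! = 4ⁿ n! (1/2)_n`;
  hence `γ(n+j)·(n+1/2)_j·M_{2n} = γ(n)·M_{2n+2j}` (`xiTaylorCoeff_ratio_skeleton`): the shifted
  coefficient ratios of `ξ` are those of the Pochhammer sequence with `b = n + 1/2` times the moment
  ratios `M_{2n+2j}/M_{2n}`, and `J^{d,n}_γ` for CONSTANT even moments `M` would be exactly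
  `(64 M d!/(1/2)_{n+d}) · L_d^{(n−1/2)}(−X)` (`jensenPoly_const_moment_skeleton`).

The normalisation `(2m)!` ↔ `m!` behind `b = n + 1/2` is Csordas–Norfolk–Varga 1986 (1.4)–(1.6).
No analysis is done here; all statements are algebraic identities.

## References
* [DimitrovBencheikh2009] D. K. Dimitrov, Y. Ben Cheikh, *Laguerre polynomials as Jensen polynomials of
  Laguerre–Pólya entire functions*, J. Comput. Appl. Math. 233 (2009) 703–707, §3.
* [OSullivan2022Limits] C. O'Sullivan, *Limits of Jensen polynomials for partitions and other sequences*,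
  Monatsh. Math. 199 (2022) 203–230, §9 (Gamma sequences).
* [OSullivan2021] C. O'Sullivan, *Zeros of Jensen polynomials and asymptotics for the Riemann xi
  function*, Res. Math. Sci. 8 (2021) no. 46, §3.3.
* [CsordasNorfolkVarga1986] G. Csordas, T. S. Norfolk, R. S. Varga, Trans. AMS 296 (1986), (1.4)–(1.6).
-/

open Polynomial Finset
open scoped Nat

namespace Literature.NumberTheory.LFunctions

open Literature.Analysis.SpecialFunctions (laguerre laguerreCoeff coeff_laguerre_comp_neg_X
  natDegree_laguerre ascPochhammer_eval_mul_eval_add ascPochhammer_eval_pos)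
open Literature.Analysis.Complex.PolyaSchur (coeff_jensenPoly)

noncomputable section

/-! ### Jensen polynomials of the Pochhammer sequence -/

/-- **Jensen polynomials of the Bessel/Gamma sequence are Laguerre polynomials.** For `b > 0`, `c ∈ ℝ`
and `γ_k = c/(b)_k` (`= c Γ(b)/Γ(b+k)`): `J^{d,n}_γ(X) = (c·d!/(b)_{n+d}) · L_d^{(b+n−1)}(−X)`
(Dimitrov–Ben Cheikh 2009 §3 for `n = 0`; with the shift `n` this is O'Sullivan 2022 §9,
`J^{d,n}_{1/Γ(·+β)}(X) = (d!/Γ(n+d+β)) L_d^{(n+β−1)}(−X)`, `b = β`). [cite: DimitrovBencheikh2009, §3] -/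
theorem jensenPoly_pochhammerInv {b : ℝ} (hb : 0 < b) (c : ℝ) (d n : ℕ) :
    jensenPoly (fun k => c / (ascPochhammer ℝ k).eval b) d n
      = C (c * (d ! : ℝ) / (ascPochhammer ℝ (n + d)).eval b) * (laguerre (b + n - 1) d).comp (-X) := by
  ext j
  rw [coeff_jensenPoly, coeff_C_mul]
  rcases Nat.lt_or_ge d j with hj | hj
  · -- beyond the degree
    rw [if_neg (not_le.mpr hj)]
    have hdeg : ((laguerre (b + n - 1) d).comp (-X)).natDegree < j := by
      rw [natDegree_comp, natDegree_laguerre, natDegree_neg, natDegree_X, mul_one]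
      exact hj
    rw [coeff_eq_zero_of_natDegree_lt hdeg, mul_zero]
  · rw [if_pos hj, coeff_laguerre_comp_neg_X (b + n - 1) hj]
    have hsplit := ascPochhammer_eval_mul_eval_add (n + j) (d - j) b
    have e1 : n + j + (d - j) = n + d := by omega
    rw [e1] at hsplit
    have e2 : (b + ↑n - 1 + ↑j + 1 : ℝ) = b + ↑(n + j) := by push_cast; ring
    rw [e2, ← hsplit]
    have h1 : (ascPochhammer ℝ (n + j)).eval b ≠ 0 := (ascPochhammer_eval_pos hb _).ne'
    have h2 : (ascPochhammer ℝ (d - j)).eval (b + ↑(n + j)) ≠ 0 :=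
      (ascPochhammer_eval_pos (by positivity) _).ne'
    have h3 : ((d - j)! : ℝ) ≠ 0 := by positivity
    have h4 : (j ! : ℝ) ≠ 0 := by positivity
    rw [Nat.cast_choose ℝ hj]
    field_simp

/-! ### The `ξ` side: `γ(n) · (1/2)_n = 64 · M_{2n}` -/

/-- `(2n)! = 4ⁿ · n! · (1/2)_n`. [cite: DLMF, 5.2.5] -/
theorem cast_factorial_two_mul (n : ℕ) :
    ((2 * n)! : ℝ) = 4 ^ n * (n ! : ℝ) * (ascPochhammer ℝ n).eval (1 / 2 : ℝ) := by
  induction n with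
  | zero => simp
  | succ n ih =>
    rw [show 2 * (n + 1) = 2 * n + 1 + 1 by ring, Nat.factorial_succ, Nat.factorial_succ,
      ascPochhammer_succ_eval, Nat.factorial_succ n]
    push_cast
    rw [ih]
    ring

/-- **The Pochhammer skeleton of `ξ`'s Taylor coefficients**: `γ(n) · (1/2)_n = 64 · M_{2n}`
(from `γ(n) = 64·4ⁿ·n!/(2n)!·M_{2n}`, i.e. the `(2m)! ↔ m!` normalisation of
Csordas–Norfolk–Varga 1986 (1.4)–(1.6)). [cite: CsordasNorfolkVarga1986, (1.4)-(1.6)] -/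
theorem xiTaylorCoeff_mul_ascPochhammer (n : ℕ) :
    xiTaylorCoeff n * (ascPochhammer ℝ n).eval (1 / 2 : ℝ) = 64 * xiMoment (2 * n) := by
  rw [xiTaylorCoeff_eq_xiMoment, cast_factorial_two_mul]
  have h1 : (n ! : ℝ) ≠ 0 := by positivity
  have h2 : (ascPochhammer ℝ n).eval (1 / 2 : ℝ) ≠ 0 := (ascPochhammer_eval_pos (by norm_num) _).ne'
  have h3 : (4 : ℝ) ^ n ≠ 0 := by positivity
  field_simp

/-- `γ(n) = 64 · M_{2n} / (1/2)_n`. [cite: CsordasNorfolkVarga1986, (1.4)-(1.6)] -/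
theorem xiTaylorCoeff_eq_xiMoment_div_ascPochhammer (n : ℕ) :
    xiTaylorCoeff n = 64 * xiMoment (2 * n) / (ascPochhammer ℝ n).eval (1 / 2 : ℝ) := by
  have h2 : (ascPochhammer ℝ n).eval (1 / 2 : ℝ) ≠ 0 := (ascPochhammer_eval_pos (by norm_num) _).ne'
  rw [eq_div_iff h2, xiTaylorCoeff_mul_ascPochhammer]

/-- **Shifted ratios = Pochhammer skeleton × moment ratio**:
`γ(n+j) · (n + 1/2)_j · M_{2n} = γ(n) · M_{2(n+j)}`, i.e. `γ(n+j)/γ(n) = (M_{2n+2j}/M_{2n}) / (n+1/2)_j`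
whenever the denominators are nonzero. [cite: CsordasNorfolkVarga1986, (1.4)-(1.6)] -/
theorem xiTaylorCoeff_ratio_skeleton (n j : ℕ) :
    xiTaylorCoeff (n + j) * (ascPochhammer ℝ j).eval ((n : ℝ) + 1 / 2) * xiMoment (2 * n)
      = xiTaylorCoeff n * xiMoment (2 * (n + j)) := by
  have hsplit := ascPochhammer_eval_mul_eval_add n j (1 / 2 : ℝ)
  have hn : (ascPochhammer ℝ n).eval (1 / 2 : ℝ) ≠ 0 := (ascPochhammer_eval_pos (by norm_num) _).ne'
  have key : xiTaylorCoeff (n + j) * (ascPochhammer ℝ j).eval ((n : ℝ) + 1 / 2) * xiMoment (2 * n)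
      * (ascPochhammer ℝ n).eval (1 / 2 : ℝ)
      = xiTaylorCoeff n * xiMoment (2 * (n + j)) * (ascPochhammer ℝ n).eval (1 / 2 : ℝ) := by
    calc xiTaylorCoeff (n + j) * (ascPochhammer ℝ j).eval ((n : ℝ) + 1 / 2) * xiMoment (2 * n)
          * (ascPochhammer ℝ n).eval (1 / 2 : ℝ)
        = (xiTaylorCoeff (n + j) * (ascPochhammer ℝ (n + j)).eval (1 / 2 : ℝ)) * xiMoment (2 * n) := by
          rw [← hsplit, add_comm (1 / 2 : ℝ) n]; ring
      _ = 64 * xiMoment (2 * (n + j)) * xiMoment (2 * n) := by rw [xiTaylorCoeff_mul_ascPochhammer]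
      _ = xiTaylorCoeff n * xiMoment (2 * (n + j)) * (ascPochhammer ℝ n).eval (1 / 2 : ℝ) := by
          linear_combination (-(xiMoment (2 * (n + j)))) * xiTaylorCoeff_mul_ascPochhammer n
  exact mul_right_cancel₀ hn key

/-- The Jensen polynomials of `ξ` written through the Pochhammer skeleton and the moments:
`J^{d,n}_γ = J^{d,n}_{γ̃}` with `γ̃_k = 64·M_{2k}/(1/2)_k`. [cite: CsordasNorfolkVarga1986, (1.4)-(1.6)] -/
theorem jensenPoly_xiTaylorCoeff_eq_moment_skeleton (d n : ℕ) :
    jensenPoly xiTaylorCoeff d n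
      = jensenPoly (fun k => 64 * xiMoment (2 * k) / (ascPochhammer ℝ k).eval (1 / 2 : ℝ)) d n := by
  have h : xiTaylorCoeff = fun k => 64 * xiMoment (2 * k) / (ascPochhammer ℝ k).eval (1 / 2 : ℝ) :=
    funext xiTaylorCoeff_eq_xiMoment_div_ascPochhammer
  rw [← h]

/-- **The skeleton as a Laguerre polynomial** (FACT B of the jensen cell, as printed in
O'Sullivan 2022 §9 with `β = 1/2`): if the even moments were a constant `M`, i.e. for the model
sequence `γ⁰_k = 64 M/(1/2)_k`, the shift-`n` Jensen polynomial is
`(64 M · d!/(1/2)_{n+d}) · L_d^{(n − 1/2)}(−X)`. [cite: DimitrovBencheikh2009, §3] -/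
theorem jensenPoly_const_moment_skeleton (M : ℝ) (d n : ℕ) :
    jensenPoly (fun k => 64 * M / (ascPochhammer ℝ k).eval (1 / 2 : ℝ)) d n
      = C (64 * M * (d ! : ℝ) / (ascPochhammer ℝ (n + d)).eval (1 / 2 : ℝ))
        * (laguerre ((n : ℝ) - 1 / 2) d).comp (-X) := by
  rw [jensenPoly_pochhammerInv (by norm_num : (0 : ℝ) < 1 / 2) (64 * M) d n]
  congr 2
  ring

end

end Literature.NumberTheory.LFunctions
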